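import Mathlib

/-!
# Crux `TwoProducts` (stmt-5906), line `FrameRungTwo`: dissociated sumset CANCELLATION `X ⊕ S = Y ⊕ S ⇒ X = Y`

Helper for the open core `stub_crossCancelCount` of the registered line `Cruxes/TwoProducts/Lines/FrameRungTwo.lean`, in the
regime analysis of its algebra-free content (SD) (`…FrameRungTwoSymmDiff.lean`, p585202; calibration memo
`Cruxes/TwoProducts/CALIBRATION-FrameRungTwo.md` §5): when the two dissociated frames are SCALE-ALIGNED, agreement of the two
sumsets below a level boundary of frame `A` reads `X ⊕ S = Y ⊕ S` with `S` a common complete sub-sumset, `X` one level set of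
`A` and `Y` a sumset of levels of `B`; the lemma below then forces `X = Y` as point sets (digit refinement à la de Bruijn), so
the two products live on a common refinement frame and the proved floor `DissociatedFixedK` applies.  The lemma: if `X + S`
and `Y + S` are DIRECT (every point has a unique representation) and equal, and `S ≠ ∅`, then `X = Y`.  Proof by generating
functions in the domain `MvPolynomial σ ℤ`: `𝟙_X · 𝟙_S = 𝟙_{X+S} = 𝟙_{Y+S} = 𝟙_Y · 𝟙_S`, cancel `𝟙_S ≠ 0`.  Stated for any
exponent type `σ →₀ ℕ`; only Mathlib is used.  Nothing here bears on the crux `TwoProducts` itself or on `VP ≠ VNP`. [folklore]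
-/

set_option linter.dupNamespace false

namespace Summit.ValiantsHypothesis.ValiantsHypothesis.Theorems.NewtonFramesTwoProducts.FrameRungTwoSumsetCancel

open MvPolynomial
open scoped BigOperators Pointwise

variable {σ : Type*} [DecidableEq σ]

/-- Coefficients of the indicator polynomial `𝟙_X = Σ_{x ∈ X} X^x` over `ℤ`: `1` on `X`, `0` off `X`. [folklore] -/
theorem coeff_indicator (X : Finset (σ →₀ ℕ)) (e : σ →₀ ℕ) :
    coeff e (∑ x ∈ X, monomial x (1 : ℤ)) = if e ∈ X then 1 else 0 := by
  classical
  rw [coeff_sum]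
  simp_rw [coeff_monomial]
  rw [Finset.sum_ite_eq']

/-- The indicator polynomial determines the set. [folklore] -/
theorem eq_of_indicator_eq {X Y : Finset (σ →₀ ℕ)}
    (h : ∑ x ∈ X, monomial x (1 : ℤ) = ∑ y ∈ Y, monomial y (1 : ℤ)) : X = Y := by
  classical
  ext e
  have he := congrArg (coeff e) h
  rw [coeff_indicator, coeff_indicator] at he
  by_cases hX : e ∈ X <;> by_cases hY : e ∈ Y <;> simp [hX, hY] at he <;> tauto

/-- The indicator polynomial of a nonempty set is nonzero. [folklore] -/
theorem indicator_ne_zero {S : Finset (σ →₀ ℕ)} (hS : S.Nonempty) :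
    ∑ s ∈ S, monomial s (1 : ℤ) ≠ 0 := by
  classical
  obtain ⟨s, hs⟩ := hS
  intro h0
  have := congrArg (coeff s) h0
  rw [coeff_indicator, if_pos hs, coeff_zero] at this
  exact one_ne_zero this

/-- **Direct sums multiply indicators**: if every point of `X + S` has a unique representation, then
`𝟙_X · 𝟙_S = 𝟙_{X + S}`. [folklore] -/
theorem indicator_mul_of_direct (X S : Finset (σ →₀ ℕ))
    (hdir : ∀ x ∈ X, ∀ x' ∈ X, ∀ s ∈ S, ∀ s' ∈ S, x + s = x' + s' → x = x' ∧ s = s') :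
    (∑ x ∈ X, monomial x (1 : ℤ)) * (∑ s ∈ S, monomial s (1 : ℤ)) = ∑ e ∈ X + S, monomial e (1 : ℤ) := by
  classical
  rw [Finset.sum_mul_sum, ← Finset.sum_product']
  have hinj : ∀ p ∈ X ×ˢ S, ∀ q ∈ X ×ˢ S, p.1 + p.2 = q.1 + q.2 → p = q := by
    intro p hp q hq hpq
    rw [Finset.mem_product] at hp hq
    obtain ⟨h1, h2⟩ := hdir p.1 hp.1 q.1 hq.1 p.2 hp.2 q.2 hq.2 hpq
    exact Prod.ext h1 h2
  rw [Finset.add_def, Finset.sum_image hinj]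
  refine Finset.sum_congr rfl fun p _ => ?_
  rw [monomial_mul, mul_one]

/-- **Dissociated sumset cancellation.**  If `X + S` and `Y + S` are direct (unique representation), `S` is nonempty and
`X + S = Y + S`, then `X = Y`.  (The 1-D case with intervals is de Bruijn's digit-refinement rigidity; note that WITHOUT
directness cancellation fails, e.g. `{0,1,3} + {0,1} = {0,2,3} + {0,1}` is false but `{0,1} + {0,1,2} = {0,2} + {0,1,…}`-type
coincidences of NON-direct sums abound.) [folklore] -/
theorem sumset_cancel {X Y S : Finset (σ →₀ ℕ)} (hS : S.Nonempty)
    (hX : ∀ x ∈ X, ∀ x' ∈ X, ∀ s ∈ S, ∀ s' ∈ S, x + s = x' + s' → x = x' ∧ s = s')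
    (hY : ∀ y ∈ Y, ∀ y' ∈ Y, ∀ s ∈ S, ∀ s' ∈ S, y + s = y' + s' → y = y' ∧ s = s')
    (h : X + S = Y + S) : X = Y := by
  classical
  have eX := indicator_mul_of_direct X S hX
  have eY := indicator_mul_of_direct Y S hY
  rw [h, ← eY] at eX
  exact eq_of_indicator_eq (mul_right_cancel₀ (indicator_ne_zero hS) eX)

/-- **Frame form** (the use in the aligned regime of line `FrameRungTwo`): two dissociated frames `A, B : Fin (m+1) → Finset`
that share the sub-frame of the first `m` coordinates (`A j = B j` for `j < m`, read through `Fin.castSucc`) and have the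
same full sumset have the same last level: `A (last) = B (last)`.  (Sumsets written as images of the word boxes.) [folklore] -/
theorem last_level_eq_of_sumset_eq {m : ℕ} (A B : Fin (m + 1) → Finset (σ →₀ ℕ))
    (hAB : ∀ j : Fin m, A (Fin.castSucc j) = B (Fin.castSucc j))
    (hA : ∀ a b : Fin (m + 1) → (σ →₀ ℕ), (∀ j, a j ∈ A j) → (∀ j, b j ∈ A j) → ∑ j, a j = ∑ j, b j → a = b)
    (hB : ∀ a b : Fin (m + 1) → (σ →₀ ℕ), (∀ j, a j ∈ B j) → (∀ j, b j ∈ B j) → ∑ j, a j = ∑ j, b j → a = b)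
    (hne : ∀ j, (A j).Nonempty)
    (h : (Fintype.piFinset A).image (fun a => ∑ j, a j) = (Fintype.piFinset B).image (fun b => ∑ j, b j)) :
    A (Fin.last m) = B (Fin.last m) := by
  classical
  -- the common sub-sumset `S` of the first `m` coordinates
  set A' : Fin m → Finset (σ →₀ ℕ) := fun j => A (Fin.castSucc j) with hA'
  set S : Finset (σ →₀ ℕ) := (Fintype.piFinset A').image (fun a => ∑ j, a j) with hSdef
  have hSne : S.Nonempty := by
    have : (Fintype.piFinset A').Nonempty := Fintype.piFinset_nonempty.mpr fun j => hne _
    exact this.image _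
  -- splitting a word of `Fin (m+1)` into its last letter and the rest
  have split : ∀ (C : Fin (m + 1) → Finset (σ →₀ ℕ)), (∀ j : Fin m, C (Fin.castSucc j) = A' j) →
      (Fintype.piFinset C).image (fun c => ∑ j, c j) = C (Fin.last m) + S := by
    intro C hC
    ext e
    simp only [Finset.mem_image, Fintype.mem_piFinset, Finset.mem_add, hSdef]
    constructor
    · rintro ⟨c, hc, rfl⟩
      refine ⟨c (Fin.last m), hc _, ∑ j : Fin m, c (Fin.castSucc j), ⟨fun j => c (Fin.castSucc j), fun j => ?_, rfl⟩, ?_⟩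
      · rw [← hC j]; exact hc _
      · rw [Fin.sum_univ_castSucc, add_comm]
    · rintro ⟨x, hx, s, ⟨a, ha, rfl⟩, rfl⟩
      refine ⟨Fin.snoc a x, fun j => ?_, ?_⟩
      · refine Fin.lastCases ?_ (fun i => ?_) j
        · simpa using hx
        · rw [Fin.snoc_castSucc, hC i]; exact ha i
      · rw [Fin.sum_univ_castSucc]
        simp [Fin.snoc_castSucc, Fin.snoc_last, add_comm]
  have hXS := split A (fun j => rfl)
  have hYS := split B (fun j => (hAB j).symm)
  -- directness of `A last + S` and `B last + S` from dissociation
  have direct : ∀ (C : Fin (m + 1) → Finset (σ →₀ ℕ)), (∀ j : Fin m, C (Fin.castSucc j) = A' j) →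
      (∀ a b : Fin (m + 1) → (σ →₀ ℕ), (∀ j, a j ∈ C j) → (∀ j, b j ∈ C j) → ∑ j, a j = ∑ j, b j → a = b) →
      ∀ x ∈ C (Fin.last m), ∀ x' ∈ C (Fin.last m), ∀ s ∈ S, ∀ s' ∈ S, x + s = x' + s' → x = x' ∧ s = s' := by
    intro C hC hinj x hx x' hx' s hs s' hs' hsum
    obtain ⟨a, ha, rfl⟩ := Finset.mem_image.mp hs
    obtain ⟨a', ha', rfl⟩ := Finset.mem_image.mp hs'
    have ha1 := Fintype.mem_piFinset.mp ha
    have ha2 := Fintype.mem_piFinset.mp ha'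
    have hw : ∀ j, (Fin.snoc a x : Fin (m + 1) → σ →₀ ℕ) j ∈ C j := by
      intro j
      refine Fin.lastCases ?_ (fun i => ?_) j
      · simpa using hx
      · rw [Fin.snoc_castSucc, hC i]; exact ha1 i
    have hw' : ∀ j, (Fin.snoc a' x' : Fin (m + 1) → σ →₀ ℕ) j ∈ C j := by
      intro j
      refine Fin.lastCases ?_ (fun i => ?_) j
      · simpa using hx'
      · rw [Fin.snoc_castSucc, hC i]; exact ha2 i
    have hs1 : ∑ j, (Fin.snoc a x : Fin (m + 1) → σ →₀ ℕ) j = x + ∑ j, a j := by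
      rw [Fin.sum_univ_castSucc]; simp [add_comm]
    have hs2 : ∑ j, (Fin.snoc a' x' : Fin (m + 1) → σ →₀ ℕ) j = x' + ∑ j, a' j := by
      rw [Fin.sum_univ_castSucc]; simp [add_comm]
    have heq := hinj _ _ hw hw' (by rw [hs1, hs2, hsum])
    have hxx : x = x' := by simpa using congrFun heq (Fin.last m)
    have haa : a = a' := by
      funext i
      simpa [Fin.snoc_castSucc] using congrFun heq (Fin.castSucc i)
    exact ⟨hxx, by rw [haa]⟩
  rw [hXS, hYS] at h
  exact sumset_cancel hSne (direct A (fun j => rfl) hA) (direct B (fun j => (hAB j).symm) hB) h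

end Summit.ValiantsHypothesis.ValiantsHypothesis.Theorems.NewtonFramesTwoProducts.FrameRungTwoSumsetCancel
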